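import Literature.Computability.Complexity.AdaptivePrograms
import HarnessLib

/-!
# Adaptive oracle programs: counted loops of linear growth (`loopFn`, `foldLoop`) over an oracle brick

Sequel to `AdaptivePrograms.lean` (`AdQuery.AdPres A h`: `h` is an adaptive `FP` program over the language
oracle `A`; closure under `FP` bricks, the oracle call, composition, fan-out, branching and clocked iteration
of ADDITIVE growth). The machines of the tree's reductions also use the counted loops of `BrickAlgebra.lean`
(`Brick.loopStep`, `loopFn_mem_FP`) and the folds of `FoldBricks.lean` (`Brick.foldLoop`, `foldLoop_mem_FP`),
whose bodies have LINEAR growth in the (preserved) first field — `iterate_mem_FP_of_growth`. This file gives the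
presented versions, so that e.g. the sampling/estimation loops of HILL's greedy adversary
(`HILLGreedyMachine.lean`) re-read with the distinguisher an oracle call:

* `AdPres.iterate_of_growth` — `z ↦ F^[p(|z.1|)] z` for presented `F` keeping `z.1` with
  `|F w| ≤ |w| + d(|w.1| + 1)` (the proof of `AdPres.iterate` with the block length
  `R(|z|) = q(|z| + d p(|z|)(|z| + 1))` and the replay round clipped to linear growth);
* `AdPres.loopStep`, `AdPres.loopFn` — counted loops (`Brick.loopStep`) with a presented body;
* `AdPres.clipF`, `AdPres.foldBody`, `AdPres.foldLoop`, `AdPres.foldLoop_clipF` — the folds of `FoldBricks.lean`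
  with a presented piece function and an `FP` accumulator operation.

## References

* S. Arora, B. Barak, *Computational Complexity: A Modern Approach*, CUP 2009, §3.4 with §1.3–§1.4.1
  (oracle machines; bounded and clocked loops).
* J. Håstad, R. Impagliazzo, L. A. Levin, M. Luby, SIAM J. Comput. 28 (1999), Def. 3.6.1, Lemma 6.3.2
  (the oracle machine `M^{(A)}`: sampling loops around the adversary).
-/

namespace Literature.Computability.Complexity

open _root_.Computability Polynomial OracleCompose PRelSigma Brick Plumb

namespace AdQuery

namespace AdPres

variable {A : Language Bool}

/-- The identity is in `FP`. [folklore] -/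
private theorem id_mem_FP' : (fun w : List Bool => w) ∈ FP := PolyTimeComputable.id _

/-! ### Clocked iteration of linear growth -/

/-- **Polynomially many rounds of a presented, first-field-preserving function of linear growth are
presented** (the analogue of `iterate_mem_FP_of_growth`): for presented `F` with `F(w).1 = w.1` and
`|F w| ≤ |w| + d(|w.1| + 1)`, the function `z ↦ F^[p(|z.1|)] z` is presented. Same program as
`AdPres.iterate`, with the block length `R(|z|) = q(|z| + d·p(|z|)·(|z| + 1))` (`|F^[i] z| ≤ |z| + d(|z.1|+1) i`)
and the replay round clipped to `|zᵢ| + d(|z.1| + 1)`. [cite: AroraBarak2009, §3.4 with §1.4.1 (clocked loops)] -/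
theorem iterate_of_growth {F : List Bool → List Bool} (hF : AdPres A F) (d : ℕ) (hfst : ∀ w, fstF (F w) = fstF w)
    (hd : ∀ w, (F w).length ≤ w.length + d * ((fstF w).length + 1))
    (p : Polynomial ℕ) : AdPres A (fun z => F^[p.eval (fstF z).length] z) := by
  obtain ⟨Q, G, q, hQ, hG, hFx⟩ := hF
  -- the block length
  set Rp : Polynomial ℕ := q.comp (X + C d * p * (X + 1)) with hRp
  -- projections of the replay state `S = ⟨c, ⟨r, ⟨zc, bits⟩⟩⟩`
  set RR : List Bool → List Bool := fstF ∘ sndF with hRR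
  set ZC : List Bool → List Bool := fstF ∘ sndF ∘ sndF with hZC
  set BI : List Bool → List Bool := sndF ∘ sndF ∘ sndF with hBI
  have hCCm : (fstF : List Bool → List Bool) ∈ FP := fstF_mem_FP
  have hRRm : RR ∈ FP := comp_mem_FP fstF_mem_FP sndF_mem_FP
  have hZCm : ZC ∈ FP := comp_mem_FP fstF_mem_FP (comp_mem_FP sndF_mem_FP sndF_mem_FP)
  have hBIm : BI ∈ FP := comp_mem_FP sndF_mem_FP (comp_mem_FP sndF_mem_FP sndF_mem_FP)
  -- one round of `F` read off the block, clipped to linear growth: `Ft S = (G ⟨zc, bits ↾ q|zc|⟩) ↾ (|zc| + d (|c| + 1))`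
  set Ft : List Bool → List Bool :=
    takeFn ∘ fanoutFn (concatFn ∘ fanoutFn (onesFn ∘ ZC) (polyFn (C d * (X + 1)) ∘ fstF))
      (G ∘ fanoutFn ZC (takeFn ∘ fanoutFn (polyFn q ∘ ZC) BI)) with hFt
  have hFtm : Ft ∈ FP := comp_mem_FP takeFn_mem_FP (fanoutFn_mem_FP
    (comp_mem_FP concatFn_mem_FP (fanoutFn_mem_FP (comp_mem_FP onesFn_mem_FP hZCm) (comp_mem_FP (polyFn_mem_FP _) hCCm)))
    (comp_mem_FP hG (fanoutFn_mem_FP hZCm (comp_mem_FP takeFn_mem_FP (fanoutFn_mem_FP (comp_mem_FP (polyFn_mem_FP q) hZCm) hBIm)))))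
  -- the replay round: consume a block if at least `|r|` answers are unread
  set EL : List Bool → List Bool := fanoutFn fstF (fanoutFn RR (fanoutFn Ft (dropFn ∘ fanoutFn RR BI))) with hEL
  have hELm : EL ∈ FP := fanoutFn_mem_FP hCCm (fanoutFn_mem_FP hRRm (fanoutFn_mem_FP hFtm (comp_mem_FP dropFn_mem_FP (fanoutFn_mem_FP hRRm hBIm))))
  set B : List Bool → List Bool := iteFn (ltLenF ∘ fanoutFn BI RR) (fun S => S) EL with hB
  have hBm : B ∈ FP := iteFn_mem_FP (comp_mem_FP ltLenF_mem_FP (fanoutFn_mem_FP hBIm hRRm)) id_mem_FP' hELm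
  -- the replay round keeps the first field, on every string
  have hfstB : ∀ S, (boolUnpair (B S)).1 = (boolUnpair S).1 := by
    intro S
    have hcond : (ltLenF ∘ fanoutFn BI RR) S = [decide ((BI S).length < (RR S).length)] := by simp
    by_cases hlt : (BI S).length < (RR S).length
    · rw [hB, iteFn_apply_true (by rw [hcond, decide_eq_true hlt])]
    · rw [hB, iteFn_apply_false (by rw [hcond, decide_eq_false hlt]), hEL, fanoutFn_apply, boolUnpair_boolPair]; rfl
  -- growth of the replay round, on every string
  have hBgrowth : ∀ S, (B S).length ≤ S.length + (2 * d + 6) * ((boolUnpair S).1.length + 1) := by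
    intro S
    have hcond : (ltLenF ∘ fanoutFn BI RR) S = [decide ((BI S).length < (RR S).length)] := by simp
    by_cases hlt : (BI S).length < (RR S).length
    · rw [hB, iteFn_apply_true (by rw [hcond, decide_eq_true hlt])]; exact Nat.le_add_right _ _
    · rw [hB, iteFn_apply_false (by rw [hcond, decide_eq_false hlt])]
      have h0 := length_fstF_sndF_le S
      have h1 := length_fstF_sndF_le (sndF S)
      have h2 := length_fstF_sndF_le (sndF (sndF S))
      have hFt' : (Ft S).length ≤ (fstF (sndF (sndF S))).length + d * ((fstF S).length + 1) := by
        rw [hFt]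
        simp only [Function.comp_apply, fanoutFn_apply, takeFn_boolPair, polyFn_apply, hZC, concatFn_boolPair, List.length_append,
          length_onesFn, List.length_replicate, eval_mul, eval_C, eval_add, eval_X, eval_one]
        exact List.length_take_le _ _
      rw [hEL]
      simp only [fanoutFn_apply, length_boolPair, Function.comp_apply, hRR, hBI, dropFn_boolPair, List.length_drop]
      change _ ≤ S.length + (2 * d + 6) * ((fstF S).length + 1)
      have hΔ := Nat.sub_le (sndF (sndF (sndF S))).length (fstF (sndF S)).length
      generalize (sndF (sndF (sndF S))).length - (fstF (sndF S)).length = Δ at hΔ ⊢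
      have hrhs : (2 * d + 6) * ((fstF S).length + 1) = 2 * (d * ((fstF S).length + 1)) + 6 * ((fstF S).length + 1) := by ring
      rw [hrhs]
      generalize d * ((fstF S).length + 1) = P at hFt' ⊢
      omega
  -- the replay loop, its initialisation `⟨z, bs⟩ ↦ ⟨z.1, ⟨1^{R|z|}, ⟨z, bs⟩⟩⟩`, and the two programs
  set L : List Bool → List Bool := fun S => B^[p.eval (boolUnpair S).1.length] S with hL
  have hLm : L ∈ FP := iterate_mem_FP_of_growth hBm (2 * d + 6) hfstB hBgrowth p
  set INIT : List Bool → List Bool := fanoutFn (fstF ∘ fstF) (fanoutFn (polyFn Rp ∘ fstF) (fun w => w)) with hINIT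
  have hINITm : INIT ∈ FP := fanoutFn_mem_FP (comp_mem_FP fstF_mem_FP fstF_mem_FP)
    (fanoutFn_mem_FP (comp_mem_FP (polyFn_mem_FP Rp) fstF_mem_FP) id_mem_FP')
  set QS : List Bool → List Bool :=
    iteFn (ltLenF ∘ fanoutFn BI (polyFn q ∘ ZC)) (Q ∘ fanoutFn ZC BI) (fun _ => []) ∘ L ∘ INIT with hQS
  set GS : List Bool → List Bool := ZC ∘ L ∘ INIT with hGS
  refine ⟨QS, GS, p * Rp,
    comp_mem_FP (iteFn_mem_FP (comp_mem_FP ltLenF_mem_FP (fanoutFn_mem_FP hBIm (comp_mem_FP (polyFn_mem_FP q) hZCm)))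
      (comp_mem_FP hQ (fanoutFn_mem_FP hZCm hBIm)) (const_mem_FP [])) (comp_mem_FP hLm hINITm),
    comp_mem_FP hZCm (comp_mem_FP hLm hINITm), fun z => ?_⟩
  /- ### correctness at `z` -/
  set c := fstF z with hc
  set N := p.eval c.length with hN
  set R := Rp.eval z.length with hR
  have hcz : c.length ≤ z.length := by have := length_fstF_sndF_le z; rw [← hc] at this; omega
  have hNle : N ≤ p.eval z.length := TM2Iter.eval_mono p hcz
  -- the iterates keep the first field; their lengths
  have hfsti : ∀ i, fstF (F^[i] z) = c := by
    intro i
    induction i with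
    | zero => rfl
    | succ i ih => rw [Function.iterate_succ_apply', hfst, ih]
  have hlen : ∀ i, (F^[i] z).length ≤ z.length + d * (c.length + 1) * i := by
    intro i
    induction i with
    | zero => simp
    | succ i ih =>
      rw [Function.iterate_succ_apply']
      have := hd (F^[i] z)
      rw [hfsti i] at this
      rw [Nat.mul_succ]; omega
  have hqR : ∀ i ≤ N, q.eval (F^[i] z).length ≤ R := fun i hi => by
    rw [hR, hRp, eval_comp]
    refine TM2Iter.eval_mono q ((hlen i).trans ?_)
    simp only [eval_add, eval_X, eval_mul, eval_C, eval_one]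
    have h1 : d * (c.length + 1) * i ≤ d * (z.length + 1) * p.eval z.length :=
      Nat.mul_le_mul (Nat.mul_le_mul_left d (by omega)) (hi.trans hNle)
    nlinarith [h1]
  -- the records
  have hINIT : ∀ bs, INIT (boolPair z bs) = boolPair c (boolPair (ones R) (boolPair z bs)) := fun bs => by
    rw [hINIT]; simp [← hc, ← hR]
  have hfstINIT : ∀ bs, (boolUnpair (INIT (boolPair z bs))).1 = c := fun bs => by
    rw [hINIT bs]; exact fstF_boolPair _ _
  have hB_lt : ∀ (zc t : List Bool), t.length < R → B (boolPair c (boolPair (ones R) (boolPair zc t))) =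
      boolPair c (boolPair (ones R) (boolPair zc t)) := fun zc t ht => by
    rw [hB, iteFn_apply_true]
    simp [hBI, hRR, ht]
  have hB_ge : ∀ (zc t : List Bool), R ≤ t.length → B (boolPair c (boolPair (ones R) (boolPair zc t))) =
      boolPair c (boolPair (ones R) (boolPair ((G (boolPair zc (t.take (q.eval zc.length)))).take (zc.length + d * (c.length + 1))) (t.drop R))) :=
    fun zc t ht => by
      rw [hB, iteFn_apply_false]
      · rw [hEL]; simp [hRR, hFt, hZC, hBI, length_onesFn]
      · have : ¬ t.length < R := Nat.not_lt.2 ht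
        simp [hBI, hRR, this]
  -- the true answer blocks
  set b0 := A.boolIndicator [] with hb0
  let β : ℕ → List Bool := fun i => adBits Q A (F^[i] z) (q.eval (F^[i] z).length)
  let blk : ℕ → List Bool := fun i => β i ++ List.replicate (R - q.eval (F^[i] z).length) b0
  let pre : ℕ → List Bool := fun i => ((List.range i).map blk).flatten
  have hβlen : ∀ i, (β i).length = q.eval (F^[i] z).length := fun i => length_adBits A _ _
  have hblklen : ∀ i ≤ N, (blk i).length = R := fun i hi => by
    simp only [blk, List.length_append, hβlen, List.length_replicate]
    have := hqR i hi; omega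
  have hpre_succ : ∀ i, pre (i + 1) = pre i ++ blk i := fun i => by
    simp only [pre, List.range_succ, List.map_append, List.map_singleton, List.flatten_append, List.flatten_singleton]
  -- replay: `i ≤ N` rounds of `B` consume the first `i` blocks and reach `F^[i] z`
  have hreplay : ∀ i ≤ N, ∀ t, B^[i] (boolPair c (boolPair (ones R) (boolPair z (pre i ++ t)))) =
      boolPair c (boolPair (ones R) (boolPair (F^[i] z) t)) := by
    intro i
    induction i with
    | zero => intro _ t; simp [pre]
    | succ i ih =>
      intro hi t
      rw [Function.iterate_succ_apply', hpre_succ, List.append_assoc, ih (Nat.le_of_succ_le hi) (blk i ++ t),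
        hB_ge _ _ (by rw [List.length_append, hblklen i (Nat.le_of_succ_le hi)]; omega)]
      have h1 : (blk i ++ t).take (q.eval (F^[i] z).length) = β i := by
        simp only [blk, List.append_assoc]; exact List.take_left' (hβlen i)
      have h2 : (blk i ++ t).drop R = t := List.drop_left' (hblklen i (Nat.le_of_succ_le hi))
      have h3 : (G (boolPair (F^[i] z) (β i))).take ((F^[i] z).length + d * (c.length + 1)) = F^[i + 1] z := by
        rw [← hFx, Function.iterate_succ_apply']
        refine List.take_of_length_le ?_
        have := hd (F^[i] z)
        rwa [hfsti i] at this
      rw [h1, h2, h3]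
  -- the loop on `⟨z, pre i ++ t⟩` with a short tail `t` ends in `⟨c, 1^R, F^[i] z, t⟩`
  have hloop : ∀ i ≤ N, ∀ t, t.length < R → L (INIT (boolPair z (pre i ++ t))) = boolPair c (boolPair (ones R) (boolPair (F^[i] z) t)) := by
    intro i hi t ht
    rw [hL]
    dsimp only
    rw [hfstINIT, ← hN, hINIT, show N = (N - i) + i by omega, Function.iterate_add_apply, hreplay i hi t]
    exact Function.iterate_fixed (hB_lt _ t ht) _
  -- the transcript, block by block: `γ i j` = the first `j` answers of block `i`
  let γ : ℕ → ℕ → List Bool := fun i j =>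
    if j ≤ q.eval (F^[i] z).length then adBits Q A (F^[i] z) j else β i ++ List.replicate (j - q.eval (F^[i] z).length) b0
  have hγlen : ∀ i j, (γ i j).length = j := fun i j => by
    by_cases h : j ≤ q.eval (F^[i] z).length
    · simp only [γ, if_pos h, length_adBits]
    · simp only [γ, if_neg h, List.length_append, hβlen, List.length_replicate]; omega
  have hγ0 : ∀ i, γ i 0 = [] := fun i => by simp only [γ, if_pos (Nat.zero_le _), adBits_zero]
  have hγR : ∀ i ≤ N, γ i R = blk i := fun i hi => by
    by_cases h : R ≤ q.eval (F^[i] z).length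
    · have he : q.eval (F^[i] z).length = R := le_antisymm (hqR i hi) h
      simp only [γ, if_pos h, blk, β, he, Nat.sub_self, List.replicate_zero, List.append_nil]
    · simp only [γ, if_neg h, blk]
  have hstep : ∀ i ≤ N, ∀ j < R, adBits QS A z (i * R + j) = pre i ++ γ i j → adBits QS A z (i * R + j + 1) = pre i ++ γ i (j + 1) := by
    intro i hi j hj hij
    rw [adBits_succ, hij]
    -- the query after `pre i ++ γ i j`
    have hQv : QS (boolPair z (pre i ++ γ i j)) =
        if j < q.eval (F^[i] z).length then Q (boolPair (F^[i] z) (γ i j)) else [] := by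
      rw [hQS, Function.comp_apply, Function.comp_apply, hloop i hi _ (by rw [hγlen]; exact hj)]
      have hcond : (ltLenF ∘ fanoutFn BI (polyFn q ∘ ZC)) (boolPair c (boolPair (ones R) (boolPair (F^[i] z) (γ i j)))) =
          [decide (j < q.eval (F^[i] z).length)] := by simp [hBI, hZC, hγlen]
      by_cases hlt : j < q.eval (F^[i] z).length
      · rw [iteFn_apply_true (by rw [hcond, decide_eq_true hlt]), if_pos hlt]; simp [hZC, hBI]
      · rw [iteFn_apply_false (by rw [hcond, decide_eq_false hlt]), if_neg hlt]
    rw [hQv]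
    by_cases hlt : j < q.eval (F^[i] z).length
    · rw [if_pos hlt]
      have hj1 : γ i j = adBits Q A (F^[i] z) j := by simp only [γ, if_pos hlt.le]
      have hj2 : γ i (j + 1) = adBits Q A (F^[i] z) (j + 1) := by simp only [γ, if_pos (Nat.succ_le_of_lt hlt)]
      rw [hj1, hj2, adBits_succ, List.append_assoc]
    · rw [if_neg hlt]
      have hj2 : γ i (j + 1) = γ i j ++ [b0] := by
        have hnot : ¬ j + 1 ≤ q.eval (F^[i] z).length := fun h => hlt h
        by_cases heq : j ≤ q.eval (F^[i] z).length
        · have hje : j = q.eval (F^[i] z).length := le_antisymm heq (Nat.not_lt.1 hlt)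
          simp only [γ, if_pos heq, if_neg hnot, β]
          rw [← hje, Nat.add_sub_cancel_left, List.replicate_one]
        · simp only [γ, if_neg heq, if_neg hnot, List.append_assoc]
          rw [show j + 1 - q.eval (F^[i] z).length = (j - q.eval (F^[i] z).length) + 1 by omega, List.replicate_succ']
      rw [hj2, List.append_assoc]
  have hblocks : ∀ i ≤ N, ∀ j ≤ R, adBits QS A z (i * R + j) = pre i ++ γ i j := by
    intro i
    induction i with
    | zero =>
      intro _ j
      induction j with
      | zero => intro _; simp [pre, hγ0]
      | succ j ih => intro hj; exact hstep 0 (Nat.zero_le _) j hj (ih (Nat.le_of_succ_le hj))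
    | succ i ihi =>
      intro hi j
      induction j with
      | zero =>
        intro _
        rw [Nat.add_zero, Nat.succ_mul, ihi (Nat.le_of_succ_le hi) R le_rfl, hγR i (Nat.le_of_succ_le hi), hpre_succ, hγ0,
          List.append_nil]
      | succ j ih => intro hj; exact hstep (i + 1) hi j hj (ih (Nat.le_of_succ_le hj))
  -- the output map replays all `N` rounds from the full transcript
  have htot : N * R ≤ (p * Rp).eval z.length := by rw [eval_mul, ← hR]; exact Nat.mul_le_mul_right R hNle
  set T := adBits QS A z ((p * Rp).eval z.length) with hT
  have hTsplit : T = pre N ++ T.drop (N * R) := by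
    have h0 := hblocks N le_rfl 0 (Nat.zero_le _)
    rw [Nat.add_zero, hγ0, List.append_nil] at h0
    conv_lhs => rw [← List.take_append_drop (N * R) T]
    rw [hT, adBits_take A z htot, h0]
  change F^[p.eval (fstF z).length] z = GS (boolPair z T)
  rw [← hc, ← hN, hGS, Function.comp_apply, Function.comp_apply, hL]
  dsimp only
  rw [hfstINIT, ← hN, hINIT, hTsplit, hreplay N le_rfl]
  simp [hZC]

/-! ### Counted loops and folds -/

/-- **`loopStep body` is presented** for a presented body. [cite: AroraBarak2009, §1.3 (bounded loops)] -/
theorem loopStep {body : List Bool → List Bool} (h : AdPres A body) : AdPres A (Brick.loopStep body) :=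
  (of_mem_FP (comp_mem_FP isNilFn_mem_FP (nthF_mem_FP 1))).ite
    (of_mem_FP (fanoutFn_mem_FP (nthF_mem_FP 0) (fanoutFn_mem_FP (nthF_mem_FP 1) (sndPow_mem_FP 1))))
    ((of_mem_FP (nthF_mem_FP 0)).fanout ((of_mem_FP predCntF_mem_FP).fanout h))

/-- **Counted loops with a presented body are presented** (the analogue of `loopFn_mem_FP`).
[cite: AroraBarak2009, §1.3 (bounded loops), §1.4.1] -/
theorem loopFn {body : List Bool → List Bool} (h : AdPres A body) {c : ℕ}
    (hbody : ∀ z, (body z).length ≤ (sndPow 1 z).length + c * ((fstF z).length + 1)) (p : Polynomial ℕ) :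
    AdPres A (fun z => (Brick.loopStep body)^[p.eval (fstF z).length] z) :=
  iterate_of_growth (loopStep h) (c + 4) (fun w => fstF_loopStep body w) (fun w => length_loopStep_le hbody w) p

/-- `clipF C f` is presented for presented `f`. [folklore] -/
theorem clipF (C : ℕ) {f : List Bool → List Bool} (hf : AdPres A f) : AdPres A (Brick.clipF C f) :=
  (of_mem_FP takeFn_mem_FP).comp ((of_mem_FP (comp_mem_FP (polyFn_mem_FP _) fstF_mem_FP)).fanout hf)

/-- `foldBody op f` is presented for `op ∈ FP` and presented `f`. [folklore] -/
theorem foldBody {op f : List Bool → List Bool} (hop : op ∈ FP) (hf : AdPres A f) : AdPres A (Brick.foldBody op f) :=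
  (of_mem_FP (comp_mem_FP (cons_mem_FP true) (nthF_mem_FP 2))).fanout
    ((of_mem_FP hop).comp ((of_mem_FP (sndPow_mem_FP 2)).fanout (hf.comp_FP (fanoutFn_mem_FP (nthF_mem_FP 0) (nthF_mem_FP 2)))))

/-- **The fold loop with a presented piece function is presented** (the analogue of `foldLoop_mem_FP`).
[cite: AroraBarak2009, §1.3 (bounded loops), §1.4.1] -/
theorem foldLoop {op f : List Bool → List Bool} {d C : ℕ} (hop : op ∈ FP)
    (hopg : ∀ w, (op w).length ≤ (fstF w).length + (sndF w).length + d) (hf : AdPres A f)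
    (hfg : ∀ w, (f w).length ≤ C * ((fstF w).length + 1)) (p : Polynomial ℕ) : AdPres A (Brick.foldLoop op f p) :=
  loopFn (foldBody hop hf) (length_foldBody_le hopg hfg) p

/-- The fold loop with a clipped presented piece function is presented. [folklore] -/
theorem foldLoop_clipF {op f : List Bool → List Bool} {d : ℕ} (C : ℕ) (hop : op ∈ FP)
    (hopg : ∀ w, (op w).length ≤ (fstF w).length + (sndF w).length + d) (hf : AdPres A f) (p : Polynomial ℕ) :
    AdPres A (Brick.foldLoop op (Brick.clipF C f) p) :=
  foldLoop hop hopg (clipF C hf) (length_clipF_le C f) p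

end AdPres

end AdQuery

end Literature.Computability.Complexity
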